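import Summits.Ventures.HSemireg.EmbeddedFirstOrderDeformationsBaseChange

/-!
# Venture HSemireg — `R[ε] → T⁻¹R[ε]` IS a localisation: `(T⁻¹R)[ε] = T⁻¹(R[ε])`
# (the trivial first-order thickening restricted to the open `Spec T⁻¹R` is the trivial thickening of `T⁻¹R`)

HONEST FRAMING.  Lean side of the computation cell `pub-hsemireg` (track «S4-PUSH» (ii), seat s4-prove-3 g3, second route
for (S5)); log `s4push/prove-3/ATTEMPT-6.md` §5.  Plain commutative algebra; no scheme, sheaf, Čech complex or semiregularity
map is constructed; nothing here says that HC, HC_CM or HC_AV holds; no object is certified; no Literature fact is declared.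

WHY.  `EmbeddedFirstOrderDeformationsBaseChange` base-changes the local dictionary (Hartshorne Prop. 2.3 / Prop. K's local
step) along `f[ε] := mapRingHom f : R[ε] →+* S[ε]` and, for `S = T⁻¹R`, constructs the localised normal vector.  For the
GLUING half of Prop. K's Čech sentence (compatible local flat lifts on a Zariski cover glue to a global flat lift — descent of
ideals along `R[ε] → R[ε]_{f_α}`) one needs to know that the chart rings of the thickening ARE localisations of `R[ε]`:
**`T⁻¹R[ε]` with the structure map `(algebraMap R T⁻¹R)[ε]` is the localisation of `R[ε]` at the image of `T`**
(`isLocalization_mapRingHom`).  Elementary (`a/s + ε b/t = (at + ε bs)/(st)`; units `s + ε·0`; `x/1 = 0 ⟺ ∃ t, t x = 0`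
componentwise), recorded here so that descent statements about ideals of `R[ε]` can quote Mathlib's `IsLocalization` API.

CONTENT, namespace `Summit.Ventures.HSemireg.EmbeddedDeformation`: `isUnit_inl_algebraMap` (units), `mapRingHom_surj`
(every `z ∈ T⁻¹R[ε]` is `f[ε](x) · (s/1)⁻¹`), `exists_of_mapRingHom_eq` (kernel relation), **`isLocalization_mapRingHom`**.

References: R. Hartshorne, *Deformation Theory*, GTM 257 (2010), Ch. 1 §2, Thm. 2.4 («compatible with localization»);
Mathlib `IsLocalization`.
-/

open DualNumber TrivSqZeroExt

namespace Summit.Ventures.HSemireg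

namespace EmbeddedDeformation

universe u v

variable {R : Type u} [CommRing R] (T : Submonoid R) (S : Type v) [CommRing S] [Algebra R S] [IsLocalization T S]

/-- `s/1 + ε·0` is a unit of `T⁻¹R[ε]` for `s ∈ T`. [folklore] -/
theorem isUnit_inl_algebraMap (s : T) : IsUnit (inl (algebraMap R S s) : S[ε]) :=
  (IsLocalization.map_units S s).map (TrivSqZeroExt.inlHom S S)

/-- **Surjectivity up to units**: every `z ∈ T⁻¹R[ε]` satisfies `z · (s/1) = f[ε](x)` for some `x ∈ R[ε]`, `s ∈ T`
(`a/s + ε b/t = (at + ε bs)/(st)`). [folklore] -/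
theorem mapRingHom_surj (z : S[ε]) :
    ∃ x : R[ε] × T, z * inl (algebraMap R S (x.2 : R)) = mapRingHom (algebraMap R S) x.1 := by
  obtain ⟨⟨a, s⟩, ha⟩ := IsLocalization.surj T z.fst
  obtain ⟨⟨b, t⟩, hb⟩ := IsLocalization.surj T z.snd
  dsimp only at ha hb
  refine ⟨⟨inl (a * t) + (ε : R[ε]) * inl (b * s), s * t⟩, ?_⟩
  show z * inl (algebraMap R S ((s : R) * t)) = mapRingHom (algebraMap R S) (inl (a * t) + ε * inl (b * s))
  rw [mapRingHom_inl_add_eps_mul_inl, map_mul, map_mul, map_mul]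
  ext
  · rw [fst_inl_add_eps_mul_inl, TrivSqZeroExt.fst_mul, fst_inl]
    linear_combination (algebraMap R S (t : R)) * ha
  · rw [snd_inl_add_eps_mul_inl, DualNumber.snd_mul, fst_inl, snd_inl, mul_zero, zero_add]
    linear_combination (algebraMap R S (s : R)) * hb

/-- **The kernel relation**: if `f[ε](x) = f[ε](y)` in `T⁻¹R[ε]` then `c·x = c·y` for some `c ∈ T` (componentwise
`IsLocalization.exists_of_eq`, with a common multiplier). [folklore] -/
theorem exists_of_mapRingHom_eq {x y : R[ε]} (h : mapRingHom (algebraMap R S) x = mapRingHom (algebraMap R S) y) :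
    ∃ c : T, inl (c : R) * x = inl (c : R) * y := by
  have h1 : algebraMap R S x.fst = algebraMap R S y.fst := by simpa using congrArg TrivSqZeroExt.fst h
  have h2 : algebraMap R S x.snd = algebraMap R S y.snd := by simpa using congrArg TrivSqZeroExt.snd h
  obtain ⟨c₁, hc₁⟩ := IsLocalization.exists_of_eq (M := T) h1
  obtain ⟨c₂, hc₂⟩ := IsLocalization.exists_of_eq (M := T) h2
  refine ⟨c₁ * c₂, ?_⟩
  ext
  · simp only [TrivSqZeroExt.fst_mul, fst_inl, Submonoid.coe_mul]
    linear_combination (c₂ : R) * hc₁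
  · simp only [DualNumber.snd_mul, fst_inl, snd_inl, zero_mul, add_zero, Submonoid.coe_mul]
    linear_combination (c₁ : R) * hc₂

/-- **`T⁻¹R[ε]` is the localisation of `R[ε]` at (the image of) `T`**, with structure map `f[ε]` for `f : R → T⁻¹R` the
localisation map: the trivial first-order thickening of `Spec R` restricted to the open `Spec T⁻¹R` is the trivial
first-order thickening of `Spec T⁻¹R`. [cite: Hartshorne2010, §2 Thm. 2.4 («compatible with localization»)] -/
theorem isLocalization_mapRingHom :
    @IsLocalization R[ε] _ (T.map (algebraMap R R[ε])) S[ε] _ (mapRingHom (algebraMap R S)).toAlgebra := by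
  letI : Algebra R[ε] S[ε] := (mapRingHom (algebraMap R S)).toAlgebra
  have halg : ∀ x : R[ε], algebraMap R[ε] S[ε] x = mapRingHom (algebraMap R S) x := fun _ ↦ rfl
  rw [isLocalization_iff]
  refine ⟨?_, ?_, ?_⟩
  · rintro ⟨_, s, hs, rfl⟩
    change IsUnit (mapRingHom (algebraMap R S) (inl s))
    rw [mapRingHom_inl]
    exact isUnit_inl_algebraMap T S ⟨s, hs⟩
  · intro z
    obtain ⟨⟨x, s⟩, hx⟩ := mapRingHom_surj T S z
    refine ⟨⟨x, ⟨algebraMap R R[ε] s, Submonoid.mem_map_of_mem _ s.2⟩⟩, ?_⟩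
    change z * mapRingHom (algebraMap R S) (inl (s : R)) = mapRingHom (algebraMap R S) x
    rw [mapRingHom_inl]
    exact hx
  · intro x y hxy
    rw [halg, halg] at hxy
    obtain ⟨c, hc⟩ := exists_of_mapRingHom_eq T S hxy
    exact ⟨⟨algebraMap R R[ε] c, Submonoid.mem_map_of_mem _ c.2⟩, hc⟩

end EmbeddedDeformation

end Summit.Ventures.HSemireg
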